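import Literature.Probability.RandomPlanarGeometry.PlaneNonIntersectionSandwich
import HarnessLib

/-!
# The remaining normalisations of the planar non-intersection probability

Eleventh file of the `PlaneNonIntersection` story (named fact
`LSW2001_srw_nonIntersection_five_eighths`, `PlaneNonIntersection.lean`; sandwich and transfer of
power laws in `PlaneNonIntersectionSandwich.lean`). Theorems only. The random-walk estimates the
fact rests on are printed for two walks from a COMMON start in slightly different conventions —
Lawler 1996, EJP 1:13, Thm 1.3 (6): `P{S¹[0,n] ∩ S²(0,n] = ∅}`; Lawler 1991, §3.5: `f(n)`; cut-time
counts (Lawler 1996, §1 (3) and Thms 1.1–1.2): `P{S[0,j] ∩ S(j,n] = ∅}`, i.e. two walks of UNEQUAL lengths `j`,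
`n - j` from `S_j` — and this file records, once and for all, that they are interchangeable up to
the factor `2` and monotone in each length, so that any of them can be fed through
`LSW2001_srw_nonIntersection_five_eighths_iff_lawler_f`:

* `card_filter_closed_open_eq_lawlerPairs` — Lawler's printed convention `S¹[0,n] ∩ S²(0,n] = ∅`
  counts the same pairs as `lawlerPairs n` (`S¹(0,n] ∩ S²[0,n] = ∅`) after swapping the walks;
* `lawlerPairs_le_card_filter_open_open`, `card_filter_open_open_le` — with BOTH walks open at
  the common start, `g(n) = P{S¹(0,n] ∩ S²(0,n] = ∅}` satisfies `f(n) ≤ g(n) ≤ 2 f(n)` (on the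
  event for `g` at most one walk revisits the origin, and forbidding that for `S¹`, resp. `S²`, is
  the event for `f`, resp. its swap);
* `offsetPairs_succ_left_le`, `offsetPairs_succ_right_le` and the probability forms
  `offsetPairs_div_succ_left_le`, `offsetPairs_div_succ_right_le` — the two-length count
  `offsetPairs k t u` (walks of lengths `k` from `0` and `t` from `u`, closed ranges disjoint) is
  non-increasing in each length separately after normalisation (`N(k) = offsetPairs k k e₁`,
  `16^{k} f(k+1)·… = 4 Σ_v offsetPairs k k e_v`, see the sandwich file), so two-sided bounds at
  comparable lengths follow from the diagonal ones.

## References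

* G. F. Lawler, *Cut times for simple random walk*, Electron. J. Probab. **1** (1996), paper 13,
  §1 [Lawler1996CutTimes].
* G. F. Lawler, *Intersections of Random Walks*, Birkhäuser 1991, §3.5 [Lawler1991].
* G. F. Lawler, O. Schramm, W. Werner, Acta Math. **187** (2001), §1
  [LawlerSchrammWerner2001PlaneExponents].
-/

noncomputable section

open Finset Real Literature.Probability.LatticeModels Literature.Probability.LatticeModels.SRW
open scoped BigOperators

namespace Literature.Probability.RandomPlanarGeometry

namespace PlaneNonIntersection

/-! ### Lawler's printed convention `S¹[0,n] ∩ S²(0,n] = ∅` -/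

/-- **`#{S¹[0,n] ∩ S²(0,n] = ∅} = lawlerPairs n`**: swapping the two walks matches Lawler's
printed convention (first walk closed, second open at the common start) with `lawlerPairs`
(`S¹(0,n] ∩ S²[0,n] = ∅`): Lawler 1996, Thm 1.3, display (6),
`c₇ n^{-ζ} ≤ P{S¹[0,n] ∩ S²(0,n] = ∅} ≤ c₈ n^{-ζ}` (`d = 2, 3`). (Display (3) of §1 is the
single-walk cut-time form `P{S[0,n] ∩ S[n+1,2n] = ∅}`, see `PlaneNonIntersectionCutTimes.lean`.)
[cite: Lawler1996CutTimes, Thm 1.3 (6)] -/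
theorem card_filter_closed_open_eq_lawlerPairs (n : ℕ) :
    #{x : StepSeq 2 n × StepSeq 2 n | ∀ i ≤ n, ∀ j ≤ n, 1 ≤ j → pos x.1 i ≠ pos x.2 j} =
      lawlerPairs n := by
  rw [lawlerPairs]
  refine Finset.card_bijective Prod.swap Prod.swap_bijective fun x => ?_
  simp only [Finset.mem_filter, Finset.mem_univ, true_and, Prod.fst_swap, Prod.snd_swap]
  exact ⟨fun h i hin hi1 j hjn => (h j hjn i hin hi1).symm,
    fun h i hin j hjn hj1 => (h j hjn hj1 i hin).symm⟩

/-! ### Both walks open at the common start: `f(n) ≤ g(n) ≤ 2 f(n)` -/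

/-- **`lawlerPairs n ≤ #{S¹(0,n] ∩ S²(0,n] = ∅}`** (`f ≤ g`): dropping the constraint at `S²_0`
only enlarges the count. [folklore] -/
theorem lawlerPairs_le_card_filter_open_open (n : ℕ) :
    lawlerPairs n ≤
      #{x : StepSeq 2 n × StepSeq 2 n | ∀ i ≤ n, 1 ≤ i → ∀ j ≤ n, 1 ≤ j → pos x.1 i ≠ pos x.2 j} := by
  rw [lawlerPairs]
  refine Finset.card_le_card fun x hx => ?_
  simp only [Finset.mem_filter, Finset.mem_univ, true_and] at hx ⊢
  exact fun i hin hi1 j hjn _ => hx i hin hi1 j hjn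

/-- **`#{S¹(0,n] ∩ S²(0,n] = ∅} ≤ 2 · lawlerPairs n`** (`g ≤ 2f`): on the event for `g` at most one
of the two walks revisits the origin; if `S¹` does not, the pair lies in Lawler's event
`S¹(0,n] ∩ S²[0,n] = ∅`, and otherwise `S²` does not and the pair lies in the swapped event
`S¹[0,n] ∩ S²(0,n] = ∅`; both have `lawlerPairs n` elements. [folklore] -/
theorem card_filter_open_open_le (n : ℕ) :
    #{x : StepSeq 2 n × StepSeq 2 n | ∀ i ≤ n, 1 ≤ i → ∀ j ≤ n, 1 ≤ j → pos x.1 i ≠ pos x.2 j} ≤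
      2 * lawlerPairs n := by
  set A : Finset (StepSeq 2 n × StepSeq 2 n) :=
    {x | ∀ i ≤ n, 1 ≤ i → ∀ j ≤ n, pos x.1 i ≠ pos x.2 j} with hA
  set B : Finset (StepSeq 2 n × StepSeq 2 n) :=
    {x | ∀ i ≤ n, ∀ j ≤ n, 1 ≤ j → pos x.1 i ≠ pos x.2 j} with hB
  have hAcard : #A = lawlerPairs n := by rw [hA, lawlerPairs]
  have hBcard : #B = lawlerPairs n := by rw [hB]; exact card_filter_closed_open_eq_lawlerPairs n
  have hsub : (({x | ∀ i ≤ n, 1 ≤ i → ∀ j ≤ n, 1 ≤ j → pos x.1 i ≠ pos x.2 j} :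
      Finset (StepSeq 2 n × StepSeq 2 n))) ⊆ A ∪ B := by
    intro x hx
    simp only [Finset.mem_filter, Finset.mem_univ, true_and] at hx
    rw [Finset.mem_union]
    by_cases hxA : x ∈ A
    · exact Or.inl hxA
    · right
      rw [hA] at hxA
      simp only [Finset.mem_filter, Finset.mem_univ, true_and, not_forall, not_not,
        exists_prop] at hxA
      obtain ⟨i, hin, hi1, j, hjn, hij⟩ := hxA
      -- the meeting point is `S²_0 = 0`, so `S¹` revisits the origin at time `i ≥ 1`
      have hj0 : j = 0 := by
        by_contra hj
        exact hx i hin hi1 j hjn (Nat.one_le_iff_ne_zero.2 hj) hij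
      subst hj0
      rw [pos_zero] at hij
      rw [hB]
      simp only [Finset.mem_filter, Finset.mem_univ, true_and]
      intro i' hi'n j' hj'n hj'1 heq
      rcases Nat.eq_zero_or_pos i' with hi'0 | hi'0
      · -- `S²` would revisit the origin at time `j' ≥ 1`: contradicts the event for `g` at `(i, j')`
        subst hi'0
        rw [pos_zero] at heq
        exact hx i hin hi1 j' hj'n hj'1 (hij.trans heq)
      · exact hx i' hi'n hi'0 j' hj'n hj'1 heq
  calc #({x | ∀ i ≤ n, 1 ≤ i → ∀ j ≤ n, 1 ≤ j → pos x.1 i ≠ pos x.2 j} :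
        Finset (StepSeq 2 n × StepSeq 2 n))
      ≤ #(A ∪ B) := Finset.card_le_card hsub
    _ ≤ #A + #B := Finset.card_union_le A B
    _ = 2 * lawlerPairs n := by rw [hAcard, hBcard]; ring

/-- Probability form: **`f(n) ≤ g(n) ≤ 2 f(n)`** with `g(n) = #{S¹(0,n] ∩ S²(0,n] = ∅}/16^n`.
[folklore] -/
theorem lawler_f_le_open_open_div_and_le (n : ℕ) :
    (lawlerPairs n : ℝ) / 16 ^ n ≤
        (#{x : StepSeq 2 n × StepSeq 2 n |
            ∀ i ≤ n, 1 ≤ i → ∀ j ≤ n, 1 ≤ j → pos x.1 i ≠ pos x.2 j} : ℝ) / 16 ^ n ∧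
      (#{x : StepSeq 2 n × StepSeq 2 n |
            ∀ i ≤ n, 1 ≤ i → ∀ j ≤ n, 1 ≤ j → pos x.1 i ≠ pos x.2 j} : ℝ) / 16 ^ n ≤
        2 * ((lawlerPairs n : ℝ) / 16 ^ n) := by
  constructor
  · exact div_le_div_of_nonneg_right (by exact_mod_cast lawlerPairs_le_card_filter_open_open n)
      (by positivity)
  · rw [← mul_div_assoc]
    exact div_le_div_of_nonneg_right (by exact_mod_cast card_filter_open_open_le n) (by positivity)

/-! ### Unequal lengths: `offsetPairs` is non-increasing in each length -/

/-- **`offsetPairs (k+1) t u ≤ 4 · offsetPairs k t u`**: dropping the last step of the first walk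
only enlarges the count. [folklore] -/
theorem offsetPairs_succ_left_le (k t : ℕ) (u : Site 2) :
    (offsetPairs (k + 1) t u : ℝ) ≤ 4 * offsetPairs k t u := by
  have hk : k ≤ k + 1 := Nat.le_succ k
  have hle : ∀ (α : StepSeq 2 (k + 1)) (β : StepSeq 2 t),
      (if ∀ j ≤ k + 1, ∀ i ≤ t, pos α j ≠ u + pos β i then (1 : ℝ) else 0) ≤
        if ∀ j ≤ k, ∀ i ≤ t, pos (pfxS α k hk) j ≠ u + pos β i then (1 : ℝ) else 0 := by
    intro α β
    split_ifs with ha hb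
    · exact le_rfl
    · exact absurd (fun j hj i hi => by rw [pos_pfxS α hk hj]; exact ha j (hj.trans hk) i hi) hb
    · exact zero_le_one
    · exact le_rfl
  calc (offsetPairs (k + 1) t u : ℝ)
      = ∑ α : StepSeq 2 (k + 1), ∑ β : StepSeq 2 t,
          (if ∀ j ≤ k + 1, ∀ i ≤ t, pos α j ≠ u + pos β i then (1 : ℝ) else 0) :=
        offsetPairs_eq_sum (k + 1) t u
    _ ≤ ∑ α : StepSeq 2 (k + 1), ∑ β : StepSeq 2 t,
          (if ∀ j ≤ k, ∀ i ≤ t, pos (pfxS α k hk) j ≠ u + pos β i then (1 : ℝ) else 0) :=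
        Finset.sum_le_sum fun α _ => Finset.sum_le_sum fun β _ => hle α β
    _ = 4 ^ (k + 1 - k) * ∑ α' : StepSeq 2 k, ∑ β : StepSeq 2 t,
          (if ∀ j ≤ k, ∀ i ≤ t, pos α' j ≠ u + pos β i then (1 : ℝ) else 0) :=
        sum_comp_pfxS hk (fun α' => ∑ β : StepSeq 2 t,
          if ∀ j ≤ k, ∀ i ≤ t, pos α' j ≠ u + pos β i then (1 : ℝ) else 0)
    _ = 4 * offsetPairs k t u := by rw [offsetPairs_eq_sum]; norm_num

/-- **`offsetPairs k (t+1) u ≤ 4 · offsetPairs k t u`**: dropping the last step of the second walk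
only enlarges the count. [folklore] -/
theorem offsetPairs_succ_right_le (k t : ℕ) (u : Site 2) :
    (offsetPairs k (t + 1) u : ℝ) ≤ 4 * offsetPairs k t u := by
  have ht : t ≤ t + 1 := Nat.le_succ t
  have hle : ∀ (α : StepSeq 2 k) (β : StepSeq 2 (t + 1)),
      (if ∀ j ≤ k, ∀ i ≤ t + 1, pos α j ≠ u + pos β i then (1 : ℝ) else 0) ≤
        if ∀ j ≤ k, ∀ i ≤ t, pos α j ≠ u + pos (pfxS β t ht) i then (1 : ℝ) else 0 := by
    intro α β
    split_ifs with ha hb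
    · exact le_rfl
    · exact absurd (fun j hj i hi => by rw [pos_pfxS β ht hi]; exact ha j hj i (hi.trans ht)) hb
    · exact zero_le_one
    · exact le_rfl
  calc (offsetPairs k (t + 1) u : ℝ)
      = ∑ α : StepSeq 2 k, ∑ β : StepSeq 2 (t + 1),
          (if ∀ j ≤ k, ∀ i ≤ t + 1, pos α j ≠ u + pos β i then (1 : ℝ) else 0) :=
        offsetPairs_eq_sum k (t + 1) u
    _ ≤ ∑ α : StepSeq 2 k, ∑ β : StepSeq 2 (t + 1),
          (if ∀ j ≤ k, ∀ i ≤ t, pos α j ≠ u + pos (pfxS β t ht) i then (1 : ℝ) else 0) :=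
        Finset.sum_le_sum fun α _ => Finset.sum_le_sum fun β _ => hle α β
    _ = ∑ α : StepSeq 2 k, 4 ^ (t + 1 - t) * ∑ β' : StepSeq 2 t,
          (if ∀ j ≤ k, ∀ i ≤ t, pos α j ≠ u + pos β' i then (1 : ℝ) else 0) :=
        Finset.sum_congr rfl fun α _ => sum_comp_pfxS ht (fun β' =>
          if ∀ j ≤ k, ∀ i ≤ t, pos α j ≠ u + pos β' i then (1 : ℝ) else 0)
    _ = 4 * offsetPairs k t u := by rw [offsetPairs_eq_sum, ← Finset.mul_sum]; norm_num

/-- Probability form in the first length: `offsetPairs (k+1) t u / 4^{k+1+t} ≤ offsetPairs k t u / 4^{k+t}`.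
[folklore] -/
theorem offsetPairs_div_succ_left_le (k t : ℕ) (u : Site 2) :
    (offsetPairs (k + 1) t u : ℝ) / 4 ^ (k + 1 + t) ≤ (offsetPairs k t u : ℝ) / 4 ^ (k + t) := by
  rw [div_le_div_iff₀ (by positivity) (by positivity),
    show (4 : ℝ) ^ (k + 1 + t) = 4 * 4 ^ (k + t) by rw [Nat.add_right_comm, pow_succ]; ring]
  have := offsetPairs_succ_left_le k t u
  have h4 : (0 : ℝ) ≤ 4 ^ (k + t) := by positivity
  nlinarith

/-- Probability form in the second length: `offsetPairs k (t+1) u / 4^{k+(t+1)} ≤ offsetPairs k t u / 4^{k+t}`.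
[folklore] -/
theorem offsetPairs_div_succ_right_le (k t : ℕ) (u : Site 2) :
    (offsetPairs k (t + 1) u : ℝ) / 4 ^ (k + (t + 1)) ≤ (offsetPairs k t u : ℝ) / 4 ^ (k + t) := by
  rw [div_le_div_iff₀ (by positivity) (by positivity),
    show (4 : ℝ) ^ (k + (t + 1)) = 4 * 4 ^ (k + t) by rw [← Nat.add_assoc, pow_succ]; ring]
  have := offsetPairs_succ_right_le k t u
  have h4 : (0 : ℝ) ≤ 4 ^ (k + t) := by positivity
  nlinarith

/-- **Two lengths, diagonal comparison**: for `k ≤ k'` and `t ≤ t'`,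
`offsetPairs k' t' u / 4^{k'+t'} ≤ offsetPairs k t u / 4^{k+t}` — the normalised two-length
non-intersection probability is bounded by the one at the shorter lengths (and, symmetrically, bounds
the one at any longer lengths), so the diagonal two-sided estimates control comparable lengths. [folklore] -/
theorem offsetPairs_div_le_of_le {k k' t t' : ℕ} (hk : k ≤ k') (ht : t ≤ t') (u : Site 2) :
    (offsetPairs k' t' u : ℝ) / 4 ^ (k' + t') ≤ (offsetPairs k t u : ℝ) / 4 ^ (k + t) := by
  -- walk down in the first length, then in the second
  have hleft : ∀ m t₀ : ℕ, (offsetPairs (k + m) t₀ u : ℝ) / 4 ^ (k + m + t₀) ≤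
      (offsetPairs k t₀ u : ℝ) / 4 ^ (k + t₀) := by
    intro m t₀
    induction m with
    | zero => simp
    | succ m ih =>
        calc (offsetPairs (k + (m + 1)) t₀ u : ℝ) / 4 ^ (k + (m + 1) + t₀)
            = (offsetPairs (k + m + 1) t₀ u : ℝ) / 4 ^ (k + m + 1 + t₀) := by rw [← Nat.add_assoc]
          _ ≤ (offsetPairs (k + m) t₀ u : ℝ) / 4 ^ (k + m + t₀) := offsetPairs_div_succ_left_le _ _ _
          _ ≤ _ := ih
  have hright : ∀ m : ℕ, (offsetPairs k (t + m) u : ℝ) / 4 ^ (k + (t + m)) ≤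
      (offsetPairs k t u : ℝ) / 4 ^ (k + t) := by
    intro m
    induction m with
    | zero => simp
    | succ m ih =>
        calc (offsetPairs k (t + (m + 1)) u : ℝ) / 4 ^ (k + (t + (m + 1)))
            = (offsetPairs k (t + m + 1) u : ℝ) / 4 ^ (k + (t + m + 1)) := by rw [← Nat.add_assoc]
          _ ≤ (offsetPairs k (t + m) u : ℝ) / 4 ^ (k + (t + m)) := offsetPairs_div_succ_right_le _ _ _
          _ ≤ _ := ih
  obtain ⟨m₁, rfl⟩ := Nat.exists_eq_add_of_le hk
  obtain ⟨m₂, rfl⟩ := Nat.exists_eq_add_of_le ht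
  calc (offsetPairs (k + m₁) (t + m₂) u : ℝ) / 4 ^ (k + m₁ + (t + m₂))
      ≤ (offsetPairs k (t + m₂) u : ℝ) / 4 ^ (k + (t + m₂)) := hleft m₁ (t + m₂)
    _ ≤ (offsetPairs k t u : ℝ) / 4 ^ (k + t) := hright m₂

end PlaneNonIntersection

end Literature.Probability.RandomPlanarGeometry

end
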